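import Summits.QuantumFields.YangMills.Theorems.UnitScaleTiltFluctuationComparisonRegPrGlobalSlackKernelLegCfgFixedPoint
import HarnessLib

/-!
# `UnitScaleTiltFluctuationComparisonRegPrGlobalSlackKernelLegCfgFixedPointTwoRun` — THE I-11 ROW `CfgDistCauchyΦ` FOR A FIXED-POINT BACKGROUND WITHOUT A REFERENCE OBJECT
# (crux `FluctuationComparisonRegPrIntL`, stmt-QuantumFields-20520, skeleton v5kC, STUB 3⁗χ `stub_globalTwoRunSlackFamChi`; cell `pub/ym-inputs`, seat ym-inputs-p12 = INPUT-LIST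
# I-11 row `CfgDistCauchyΦ`; count-neutral helper, registry untouched)

WHY.  The tree's only supplier of the two-run loop-variable row `CfgDistCauchyΦ` is `cfgDistCauchyΦ_of_ref` (`…KernelLegRef`): a triangle inequality through a COHERENT reference
functional `BR` («the limiting background read on both runs' lattices», `RefCfgCoherent BR`) — introduced because a cross-run row about per-run `Classical.choice` witnesses is
unprovable in principle (finding F-g4-1).  When the loop variables are characterised as THE fixed point of a contraction — [Balaban1985Variational]'s successive approximations for
the constrained minimiser, whose equation is CANONICAL (the Wilson action's, determined by the lattice and the block field alone, not by any witness) — the reference object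
and its coherence can be DISPENSED WITH: run `K`'s loop variables are the fixed point of run `K`'s map `T_K`, run `K+1`'s (pulled back along the bond matching) are the fixed point
of run `K+1`'s map, and [King1986] Prop. 3.9's replacement step reads «the two maps differ, at run `K+1`'s configuration, by the budget» — a two-cut-off difference of two CANONICAL
maps at ONE bounded configuration (the I-11 propagator row, seat p10, plus the nonlinear terms), provable for every admissible witness once (F) pins each run's `B` to its map.

* **`cfgDistCauchyΦ_of_isFixedPt_twoRun`** — `CfgDistCauchyΦ D B dist b₀ p₀ a (C₀/(1−q))` from: (F) for EVERY run, `B K (K−n) j Y (V↑)` is a fixed point of `T K (K−n) j Y (V↑)` on the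
  window / listed domains (ONE per-run display, used at run `K` and — through `LocMatched` — at run `K+1`, level `j+1`, domain `refineSet Y`); (C_w) run `K`'s map is legwise
  `w`-weighted `q`-Lipschitz on the (44)-ball, ONE `q < 1`, for a SUPPLIER-CHOSEN positive weight family `w ≤ (1+d)θ(n)x²(L^{−(1+j)})^a` (W); (S) the two-clause (44) row of record
  `CfgDistΦ D B dist b₀ p₀ C_s` (both runs' configurations lie in the ball); (M) the cross-run MAP closeness at run `K+1`'s configuration pulled back along `matchBond`:
  `‖T_K (y′ ∘ matchBond) c − (T_{K+1} y′)(matchBond c)‖ ≤ C₀·w c`.  No `BR`, no `RefCfgCoherent`, no `DistMatched`.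
* **`cfgDistCauchyΦ_chi_of_isFixedPt_twoRun`** — the χ-instance at `dataOfV3chi p (canonPolymerCore (toCore ∘ p))`, `canonLegDist F`, the record's `𝔠.b₀` and a free profile `p₁`
  (`locMatched_canonCore`).
HONEST FRAMING.  A reduction (bookkeeping + the a-posteriori contraction bound `norm_sub_le_weighted_of_isFixedPt` of `…CfgFixedPoint`); (F), (C_w), (M) for Bałaban's minimiser are
located-UNPRINTED for the non-abelian d = 3 model ([King1986] §4 is the flat U(1) template, where `T` is affine and `q = 0`); nothing of [Balaban1985UV3] / [Balaban1985Variational] /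
[King1986] is asserted; no summit / rung / gap claim (YM₃ on T³ is rung R3, not the Clay problem).

References: C. King, CMP 102 (1986) 649–677 [King1986] (Prop. 3.8 (3.71) p.664, Prop. 3.9 (3.73)–(3.74) p.665, p.665 L9–14); T. Bałaban, CMP 102 (1985) 255–275 [Balaban1985UV3]
((43)–(45) pp.266–267); CMP 102 (1985) 277–309 [Balaban1985Variational] (Thm 1 (8) p.279); CMP 109 (1987) 249–301 [Balaban1987RG1] ((0.1) p.251).
-/

set_option autoImplicit false

noncomputable section

open scoped BigOperators
open Finset
open Literature.MathematicalPhysics.QuantumFieldTheory.Balaban1983to89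
open Literature.MathematicalPhysics.QuantumFieldTheory.Balaban1983to89.T3ContinuumYM3Torus
open Literature.MathematicalPhysics.QuantumFieldTheory.Balaban1983to89.T3UnitScaleTilt
open Literature.MathematicalPhysics.QuantumFieldTheory.Balaban1983to89.T3LevelShift
open Literature.MathematicalPhysics.QuantumFieldTheory.Balaban1983to89.T3AlphaInputsAC
open Literature.MathematicalPhysics.QuantumFieldTheory.Balaban1983to89.T3AlphaPolymerSocket
open Literature.MathematicalPhysics.QuantumFieldTheory.Balaban1983to89.T3AlphaInputsACTwoRun
open Literature.MathematicalPhysics.QuantumFieldTheory.Balaban1983to89.T3AlphaInputsACTwoRunLevel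
open Literature.MathematicalPhysics.QuantumFieldTheory.Balaban1985CMP102
open Literature.MathematicalPhysics.QuantumFieldTheory.Balaban1985CMP102.Setting
open Summit.QuantumFields.Balaban3D.Carriers
open Summit.QuantumFields.Balaban3D.Proofs.Primitives
open Summit.QuantumFields.Balaban3D.Proofs.GroupModelLieC (lieC)
open Summit.QuantumFields.YangMills.Theorems
open Summit.QuantumFields.YangMills.Theorems.GlobalSlackKernelMatching
open Summit.QuantumFields.YangMills.Theorems.GlobalSlackCanonicalPolymers

namespace Summit.QuantumFields.YangMills.Theorems.GlobalSlackKernelLeg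

/-! ## §1 The two-run row from per-run fixed points and the closeness of the two maps -/

section TwoRun

variable {𝕍 : Type} [NormedAddCommGroup 𝕍] [NormedSpace ℂ 𝕍] {F : T3Family} {γ : ℝ}

omit [NormedSpace ℂ 𝕍] in
/-- **`CfgDistCauchyΦ` FOR A FIXED-POINT BACKGROUND, NO REFERENCE OBJECT.**  `T K k b Y W` = run `K`'s (canonical) defining map of its loop variables at `(k, b, Y, W)`, `w` a
positive weight family dominated by the row's budget shape (W).  If (F) for every run `B K (K−n) j Y (V↑)` is a fixed point of `T K (K−n) j Y (V↑)` on the `θ(n)`-window and the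
listed domains, (C_w) run `K`'s map is legwise `w`-weighted `q`-Lipschitz on the (44)-ball (`q < 1`, uniform), (S) `CfgDistΦ D B dist b₀ p₀ C_s` (both runs' configurations in the
ball), and (M) at run `K+1`'s configuration `y′ := B (K+1) (K+1−n) (j+1) (refineSet Y) (V↑)` the two maps are close along the bond matching,
`‖T K (K−n) j Y (V↑) (y′ ∘ matchBond) c − (T (K+1) (K+1−n) (j+1) (refineSet Y) (V↑) y′) (matchBond c)‖ ≤ C₀·w c`, then `CfgDistCauchyΦ D B dist b₀ p₀ a (C₀/(1−q))`
(`LocMatched D` carries (F) to run `K+1`'s indexing). [cite: King1986, Prop. 3.9 (3.73)-(3.74) p.665; Balaban1985Variational, Thm 1 (8) p.279; Balaban1987RG1, (0.1) p.251] -/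
theorem cfgDistCauchyΦ_of_isFixedPt_twoRun {D : AlphaDataT3 F γ} {B : CfgFam 𝕍 F} {dist : LegDist F} {b₀ p₀ a C_s q C₀ : ℝ}
    (T : (K k b : ℕ) → Set (Site (F.P K) 0) → GaugeField (F.P K) k (Matrix.specialUnitaryGroup (Fin 2) ℂ) → (PBond (F.P K) b → 𝕍) → (PBond (F.P K) b → 𝕍))
    (w : (K k b : ℕ) → Set (Site (F.P K) 0) → GaugeField (F.P K) k (Matrix.specialUnitaryGroup (Fin 2) ℂ) → PBond (F.P K) b → ℝ)
    (hLoc : LocMatched D) (hq1 : q < 1) (hC₀ : 0 ≤ C₀)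
    (hS : CfgDistΦ D B dist b₀ p₀ C_s)
    (hw : ∀ (K n : ℕ) (h : n ≤ K), ∀ j : ℕ, j < K - n →
      ∀ V : GaugeField (F.P n) 0 (Matrix.specialUnitaryGroup (Fin 2) ℂ), PlaqSmall (θBal F.L γ b₀ p₀ n) V →
        ∀ Y ∈ D.Loc K (K - n) (D.triv K (K - n)) (1 + j), ∀ c : PBond (F.P K) j,
          0 < w K (K - n) j Y (fieldShift (F.sitesPerDir_eq (m := F.m) (K := K) (j := K - n) (m' := F.m) (K' := n) (j' := 0) (by omega)) V) c ∧
          w K (K - n) j Y (fieldShift (F.sitesPerDir_eq (m := F.m) (K := K) (j := K - n) (m' := F.m) (K' := n) (j' := 0) (by omega)) V) c ≤ (1 + dist K j Y c) * θBal F.L γ b₀ p₀ n * (((F.L : ℝ) ^ (K - n - 1 - j))⁻¹) ^ 2 * (((F.L : ℝ) ^ (1 + j))⁻¹) ^ a)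
    (hfix : ∀ (K n : ℕ) (h : n ≤ K), ∀ j : ℕ, j < K - n →
      ∀ V : GaugeField (F.P n) 0 (Matrix.specialUnitaryGroup (Fin 2) ℂ), PlaqSmall (θBal F.L γ b₀ p₀ n) V →
        ∀ Y ∈ D.Loc K (K - n) (D.triv K (K - n)) (1 + j),
          T K (K - n) j Y (fieldShift (F.sitesPerDir_eq (m := F.m) (K := K) (j := K - n) (m' := F.m) (K' := n) (j' := 0) (by omega)) V) (B K (K - n) j Y (fieldShift (F.sitesPerDir_eq (m := F.m) (K := K) (j := K - n) (m' := F.m) (K' := n) (j' := 0) (by omega)) V)) = B K (K - n) j Y (fieldShift (F.sitesPerDir_eq (m := F.m) (K := K) (j := K - n) (m' := F.m) (K' := n) (j' := 0) (by omega)) V))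
    (hlip : ∀ (K n : ℕ) (h : n ≤ K), ∀ j : ℕ, j < K - n →
      ∀ V : GaugeField (F.P n) 0 (Matrix.specialUnitaryGroup (Fin 2) ℂ), PlaqSmall (θBal F.L γ b₀ p₀ n) V →
        ∀ Y ∈ D.Loc K (K - n) (D.triv K (K - n)) (1 + j), ∀ x y : PBond (F.P K) j → 𝕍,
          (∀ c, ‖x c‖ ≤ C_s * (1 + dist K j Y c) * θBal F.L γ b₀ p₀ n * (((F.L : ℝ) ^ (K - n - 1 - j))⁻¹) ^ 2) →
          (∀ c, ‖y c‖ ≤ C_s * (1 + dist K j Y c) * θBal F.L γ b₀ p₀ n * (((F.L : ℝ) ^ (K - n - 1 - j))⁻¹) ^ 2) →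
            ∀ M : ℝ, 0 ≤ M → (∀ c, ‖x c - y c‖ ≤ M * w K (K - n) j Y (fieldShift (F.sitesPerDir_eq (m := F.m) (K := K) (j := K - n) (m' := F.m) (K' := n) (j' := 0) (by omega)) V) c) →
              ∀ c, ‖T K (K - n) j Y (fieldShift (F.sitesPerDir_eq (m := F.m) (K := K) (j := K - n) (m' := F.m) (K' := n) (j' := 0) (by omega)) V) x c - T K (K - n) j Y (fieldShift (F.sitesPerDir_eq (m := F.m) (K := K) (j := K - n) (m' := F.m) (K' := n) (j' := 0) (by omega)) V) y c‖ ≤ q * M * w K (K - n) j Y (fieldShift (F.sitesPerDir_eq (m := F.m) (K := K) (j := K - n) (m' := F.m) (K' := n) (j' := 0) (by omega)) V) c)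
    (hmap : ∀ (K n : ℕ) (h : n ≤ K), ∀ j : ℕ, j < K - n →
      ∀ V : GaugeField (F.P n) 0 (Matrix.specialUnitaryGroup (Fin 2) ℂ), PlaqSmall (θBal F.L γ b₀ p₀ n) V →
        ∀ Y ∈ D.Loc K (K - n) (D.triv K (K - n)) (1 + j), ∀ c : PBond (F.P K) j,
          ‖T K (K - n) j Y (fieldShift (F.sitesPerDir_eq (m := F.m) (K := K) (j := K - n) (m' := F.m) (K' := n) (j' := 0) (by omega)) V) (fun c' => B (K + 1) (K + 1 - n) (j + 1) (refineSet F K Y) (fieldShift (F.sitesPerDir_eq (m := F.m) (K := K + 1) (j := K + 1 - n) (m' := F.m) (K' := n) (j' := 0) (by omega)) V) (matchBond F K j c')) c -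
              T (K + 1) (K + 1 - n) (j + 1) (refineSet F K Y) (fieldShift (F.sitesPerDir_eq (m := F.m) (K := K + 1) (j := K + 1 - n) (m' := F.m) (K' := n) (j' := 0) (by omega)) V) (B (K + 1) (K + 1 - n) (j + 1) (refineSet F K Y) (fieldShift (F.sitesPerDir_eq (m := F.m) (K := K + 1) (j := K + 1 - n) (m' := F.m) (K' := n) (j' := 0) (by omega)) V)) (matchBond F K j c)‖ ≤
            C₀ * w K (K - n) j Y (fieldShift (F.sitesPerDir_eq (m := F.m) (K := K) (j := K - n) (m' := F.m) (K' := n) (j' := 0) (by omega)) V) c) :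
    CfgDistCauchyΦ D B dist b₀ p₀ a (C₀ / (1 - q)) := by
  intro K n hnK j hj V hV Y hY
  set W := (fieldShift (F.sitesPerDir_eq (m := F.m) (K := K) (j := K - n) (m' := F.m) (K' := n) (j' := 0) (by omega)) V) with hW
  set W' := (fieldShift (F.sitesPerDir_eq (m := F.m) (K := K + 1) (j := K + 1 - n) (m' := F.m) (K' := n) (j' := 0) (by omega)) V) with hW'
  set x : PBond (F.P K) j → 𝕍 := B K (K - n) j Y W with hx
  set y' : PBond (F.P (K + 1)) (j + 1) → 𝕍 := B (K + 1) (K + 1 - n) (j + 1) (refineSet F K Y) W' with hy'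
  set y : PBond (F.P K) j → 𝕍 := fun c => y' (matchBond F K j c) with hy
  -- run `K+1`'s own fixed-point display at height `n`, level `j + 1`, domain `refineSet Y`
  have hY' : refineSet F K Y ∈ D.Loc (K + 1) (K + 1 - n) (D.triv (K + 1) (K + 1 - n)) (1 + (j + 1)) := by
    have hmaps := (hLoc K n hnK (1 + j) (by omega) (by omega)).mapsTo (Finset.mem_coe.mpr hY)
    rw [show 1 + (j + 1) = 1 + j + 1 by ring]
    exact Finset.mem_coe.mp hmaps
  have hfix' : T (K + 1) (K + 1 - n) (j + 1) (refineSet F K Y) W' y' = y' := hfix (K + 1) n (by omega) (j + 1) (by omega) V hV (refineSet F K Y) hY'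
  have hwY := hw K n hnK j hj V hV Y hY
  have hSY := hS K n hnK j hj V hV Y hY
  have key := norm_sub_le_weighted_of_isFixedPt (fun c => w K (K - n) j Y W c) (fun c => (hwY c).1) (T K (K - n) j Y W) hq1 x y
    (hfix K n hnK j hj V hV Y hY)
    (fun M hM hxy => hlip K n hnK j hj V hV Y hY x y (fun c => (hSY c).1) (fun c => (hSY c).2) M hM hxy)
    (fun c => by
      have h := hmap K n hnK j hj V hV Y hY c
      rwa [hfix'] at h)
  have hc : 0 ≤ C₀ / (1 - q) := div_nonneg hC₀ (by linarith)
  intro c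
  calc ‖y' (matchBond F K j c) - x c‖ = ‖x c - y c‖ := norm_sub_rev _ _
    _ ≤ C₀ / (1 - q) * w K (K - n) j Y W c := key c
    _ ≤ C₀ / (1 - q) * ((1 + dist K j Y c) * θBal F.L γ b₀ p₀ n * (((F.L : ℝ) ^ (K - n - 1 - j))⁻¹) ^ 2 * (((F.L : ℝ) ^ (1 + j))⁻¹) ^ a) :=
        mul_le_mul_of_nonneg_left (hwY c).2 hc
    _ = C₀ / (1 - q) * (1 + dist K j Y c) * θBal F.L γ b₀ p₀ n * (((F.L : ℝ) ^ (K - n - 1 - j))⁻¹) ^ 2 * (((F.L : ℝ) ^ (1 + j))⁻¹) ^ a := by ring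

end TwoRun

/-! ## §2 The χ-instance at the canonical polymerisation and a free profile -/

section Canon

variable {F : T3Family} {𝔠 : AlphaConsts F.L (suGroupModel 2).N} {γ : ℝ} {hγ : 0 < γ} {hγ1 : γ ≤ (min 𝔠.gamma0 1) ^ 2}

/-- **THE I-11 ROW AT THE χ-RECORD'S CANONICAL DATUM, NO REFERENCE OBJECT** (`cfgDistCauchyΦ_of_isFixedPt_twoRun` at `dataOfV3chi p (canonPolymerCore …)`, `canonLegDist F`,
the record's `𝔠.b₀` and any profile `p₁`; `LocMatched` = `locMatched_canonCore`). [cite: King1986, Prop. 3.9 (3.73)-(3.74) p.665; Balaban1987RG1, (0.1) p.251] -/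
theorem cfgDistCauchyΦ_chi_of_isFixedPt_twoRun (p : ∀ K, AlphaInputsT3AC.PkgAtV3Chi F 𝔠 γ hγ hγ1 K) {B : CfgFam ↥(lieC (suGroupModel 2)) F} {p₁ a C_s q C₀ : ℝ}
    (T : (K k b : ℕ) → Set (Site (F.P K) 0) → GaugeField (F.P K) k (Matrix.specialUnitaryGroup (Fin 2) ℂ) →
      (PBond (F.P K) b → ↥(lieC (suGroupModel 2))) → (PBond (F.P K) b → ↥(lieC (suGroupModel 2))))
    (w : (K k b : ℕ) → Set (Site (F.P K) 0) → GaugeField (F.P K) k (Matrix.specialUnitaryGroup (Fin 2) ℂ) → PBond (F.P K) b → ℝ)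
    (hq1 : q < 1) (hC₀ : 0 ≤ C₀)
    (hS : CfgDistΦ (AlphaInputsT3AC.dataOfV3chi p (canonPolymerCore fun K => (p K).toCore)) B (canonLegDist F) 𝔠.b₀ p₁ C_s)
    (hw : ∀ (K n : ℕ) (h : n ≤ K), ∀ j : ℕ, j < K - n →
      ∀ V : GaugeField (F.P n) 0 (Matrix.specialUnitaryGroup (Fin 2) ℂ), PlaqSmall (θBal F.L γ 𝔠.b₀ p₁ n) V →
        ∀ Y ∈ (AlphaInputsT3AC.dataOfV3chi p (canonPolymerCore fun K => (p K).toCore)).Loc K (K - n) ((AlphaInputsT3AC.dataOfV3chi p (canonPolymerCore fun K => (p K).toCore)).triv K (K - n)) (1 + j), ∀ c : PBond (F.P K) j,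
          0 < w K (K - n) j Y (fieldShift (F.sitesPerDir_eq (m := F.m) (K := K) (j := K - n) (m' := F.m) (K' := n) (j' := 0) (by omega)) V) c ∧
          w K (K - n) j Y (fieldShift (F.sitesPerDir_eq (m := F.m) (K := K) (j := K - n) (m' := F.m) (K' := n) (j' := 0) (by omega)) V) c ≤ (1 + canonLegDist F K j Y c) * θBal F.L γ 𝔠.b₀ p₁ n * (((F.L : ℝ) ^ (K - n - 1 - j))⁻¹) ^ 2 * (((F.L : ℝ) ^ (1 + j))⁻¹) ^ a)
    (hfix : ∀ (K n : ℕ) (h : n ≤ K), ∀ j : ℕ, j < K - n →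
      ∀ V : GaugeField (F.P n) 0 (Matrix.specialUnitaryGroup (Fin 2) ℂ), PlaqSmall (θBal F.L γ 𝔠.b₀ p₁ n) V →
        ∀ Y ∈ (AlphaInputsT3AC.dataOfV3chi p (canonPolymerCore fun K => (p K).toCore)).Loc K (K - n) ((AlphaInputsT3AC.dataOfV3chi p (canonPolymerCore fun K => (p K).toCore)).triv K (K - n)) (1 + j),
          T K (K - n) j Y (fieldShift (F.sitesPerDir_eq (m := F.m) (K := K) (j := K - n) (m' := F.m) (K' := n) (j' := 0) (by omega)) V) (B K (K - n) j Y (fieldShift (F.sitesPerDir_eq (m := F.m) (K := K) (j := K - n) (m' := F.m) (K' := n) (j' := 0) (by omega)) V)) = B K (K - n) j Y (fieldShift (F.sitesPerDir_eq (m := F.m) (K := K) (j := K - n) (m' := F.m) (K' := n) (j' := 0) (by omega)) V))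
    (hlip : ∀ (K n : ℕ) (h : n ≤ K), ∀ j : ℕ, j < K - n →
      ∀ V : GaugeField (F.P n) 0 (Matrix.specialUnitaryGroup (Fin 2) ℂ), PlaqSmall (θBal F.L γ 𝔠.b₀ p₁ n) V →
        ∀ Y ∈ (AlphaInputsT3AC.dataOfV3chi p (canonPolymerCore fun K => (p K).toCore)).Loc K (K - n) ((AlphaInputsT3AC.dataOfV3chi p (canonPolymerCore fun K => (p K).toCore)).triv K (K - n)) (1 + j), ∀ x y : PBond (F.P K) j → ↥(lieC (suGroupModel 2)),
          (∀ c, ‖x c‖ ≤ C_s * (1 + canonLegDist F K j Y c) * θBal F.L γ 𝔠.b₀ p₁ n * (((F.L : ℝ) ^ (K - n - 1 - j))⁻¹) ^ 2) →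
          (∀ c, ‖y c‖ ≤ C_s * (1 + canonLegDist F K j Y c) * θBal F.L γ 𝔠.b₀ p₁ n * (((F.L : ℝ) ^ (K - n - 1 - j))⁻¹) ^ 2) →
            ∀ M : ℝ, 0 ≤ M → (∀ c, ‖x c - y c‖ ≤ M * w K (K - n) j Y (fieldShift (F.sitesPerDir_eq (m := F.m) (K := K) (j := K - n) (m' := F.m) (K' := n) (j' := 0) (by omega)) V) c) →
              ∀ c, ‖T K (K - n) j Y (fieldShift (F.sitesPerDir_eq (m := F.m) (K := K) (j := K - n) (m' := F.m) (K' := n) (j' := 0) (by omega)) V) x c - T K (K - n) j Y (fieldShift (F.sitesPerDir_eq (m := F.m) (K := K) (j := K - n) (m' := F.m) (K' := n) (j' := 0) (by omega)) V) y c‖ ≤ q * M * w K (K - n) j Y (fieldShift (F.sitesPerDir_eq (m := F.m) (K := K) (j := K - n) (m' := F.m) (K' := n) (j' := 0) (by omega)) V) c)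
    (hmap : ∀ (K n : ℕ) (h : n ≤ K), ∀ j : ℕ, j < K - n →
      ∀ V : GaugeField (F.P n) 0 (Matrix.specialUnitaryGroup (Fin 2) ℂ), PlaqSmall (θBal F.L γ 𝔠.b₀ p₁ n) V →
        ∀ Y ∈ (AlphaInputsT3AC.dataOfV3chi p (canonPolymerCore fun K => (p K).toCore)).Loc K (K - n) ((AlphaInputsT3AC.dataOfV3chi p (canonPolymerCore fun K => (p K).toCore)).triv K (K - n)) (1 + j), ∀ c : PBond (F.P K) j,
          ‖T K (K - n) j Y (fieldShift (F.sitesPerDir_eq (m := F.m) (K := K) (j := K - n) (m' := F.m) (K' := n) (j' := 0) (by omega)) V) (fun c' => B (K + 1) (K + 1 - n) (j + 1) (refineSet F K Y) (fieldShift (F.sitesPerDir_eq (m := F.m) (K := K + 1) (j := K + 1 - n) (m' := F.m) (K' := n) (j' := 0) (by omega)) V) (matchBond F K j c')) c -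
              T (K + 1) (K + 1 - n) (j + 1) (refineSet F K Y) (fieldShift (F.sitesPerDir_eq (m := F.m) (K := K + 1) (j := K + 1 - n) (m' := F.m) (K' := n) (j' := 0) (by omega)) V) (B (K + 1) (K + 1 - n) (j + 1) (refineSet F K Y) (fieldShift (F.sitesPerDir_eq (m := F.m) (K := K + 1) (j := K + 1 - n) (m' := F.m) (K' := n) (j' := 0) (by omega)) V)) (matchBond F K j c)‖ ≤
            C₀ * w K (K - n) j Y (fieldShift (F.sitesPerDir_eq (m := F.m) (K := K) (j := K - n) (m' := F.m) (K' := n) (j' := 0) (by omega)) V) c) :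
    CfgDistCauchyΦ (AlphaInputsT3AC.dataOfV3chi p (canonPolymerCore fun K => (p K).toCore)) B (canonLegDist F) 𝔠.b₀ p₁ a (C₀ / (1 - q)) :=
  cfgDistCauchyΦ_of_isFixedPt_twoRun T w (locMatched_canonCore fun K => (p K).toCore) hq1 hC₀ hS hw hfix hlip hmap

end Canon

end Summit.QuantumFields.YangMills.Theorems.GlobalSlackKernelLeg

end
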